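import Literature.Topology.FourManifolds.SublevelOneHandlebody
import HarnessLib

/-!
# The levels of a `1`-handlebody above its `0`-handle are connected

Topic `Literature/Topology/FourManifolds` (fact seat
`provefact-Literature.Topology.FourManifolds.lauden-f709dd520c`, Laudenbach–Poénaru's Lemma 2: the
slide and flip contexts of a `1`-handle need the levels between the other critical values and
the top critical point to be connected).  Everything here is **proved**; no named facts.

For a Morse function `f` adapted to the boundary of a compact `(n+1)`-manifold `W`, `n ≥ 2`,
with exactly one critical point of index `0` and none of index `≥ 2` (a `1`-handlebody with
one `0`-handle), every regular level `f⁻¹(a)`, `a < 1`, above the critical point of index `0`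
is **connected** (`IsMorseAdapted.isConnected_level_of_counts`): the sublevel set `{f ≤ a}` is a
connected `1`-handlebody of the same kind (`SublevelOneHandlebody.lean`) and the boundary of a
compact connected manifold with handles of index `≤ 1 ≤ n - 1` only is connected
(`IsMorseAdapted.isPreconnected_boundary_and_nonempty`, `LickorishWallaceProofs.lean`); that
boundary is the level.

## References

* J. Milnor, *Lectures on the h-cobordism theorem* (1965), Lemma 2.9, Thm. 3.14 and Remark.
  [MilnorHCobordism1965]
* F. Laudenbach, V. Poénaru, Bull. Soc. Math. France 100 (1972), proof of Lemma 2 (p. 340).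
  [LaudenbachPoenaruBSMF1972]
-/

open scoped Manifold ContDiff Topology
open Set Function

noncomputable section

namespace Literature.Topology.FourManifolds

universe u

variable {n : ℕ} {W : Type u} [TopologicalSpace W] [T2Space W] [SecondCountableTopology W]
  [CompactSpace W] [ChartedSpace (EuclideanHalfSpace (n + 1)) W] [IsManifold (𝓡∂ (n + 1)) ∞ W]

/-- **The regular levels of a `1`-handlebody above its `0`-handle are connected** (see the
module docstring). [cite: MilnorHCobordism1965, Lemma 2.9, Thm. 3.14 and Remark] -/
theorem IsMorseAdapted.isConnected_level_of_counts (hn : 2 ≤ n) {f : W → ℝ} (hf : IsMorseAdapted (𝓡∂ (n + 1)) f)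
    {a : ℝ} (ha : a < 1) (hreg : ∀ z, IsMCriticalPt (𝓡∂ (n + 1)) f z → f z ≠ a)
    (h0 : (criticalSetOfIndex (𝓡∂ (n + 1)) f 0).ncard = 1)
    (h2 : ∀ k, 2 ≤ k → (criticalSetOfIndex (𝓡∂ (n + 1)) f k).ncard = 0)
    (hmin : ∀ z ∈ criticalSetOfIndex (𝓡∂ (n + 1)) f 0, f z < a) :
    IsConnected (f ⁻¹' {a}) := by
  have hn1 : 1 ≤ n := by omega
  haveI : NeZero n := ⟨by omega⟩
  obtain ⟨hint, hreg', hmfd, -, hF, hcrit, hidx⟩ := sublevel_morseData hn1 hf ha hreg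
  letI := (sublevelAtlas hf.1.1 a hint hreg').chartedSpace
  haveI := hmfd
  haveI : CompactSpace ↥(f ⁻¹' Iic a) :=
    isCompact_iff_compactSpace.1 ((isClosed_Iic.preimage hf.1.1.continuous).isCompact)
  haveI : ConnectedSpace ↥(f ⁻¹' Iic a) := hf.connectedSpace_sublevel hn1 ha hreg h0 h2 hmin hint hreg'
  haveI : LocallyPathConnectedSpace ↥(f ⁻¹' Iic a) :=
    ChartedSpace.locallyPathConnectedSpace (EuclideanHalfSpace (n + 1)) _
  -- every critical point of `f` has index `≤ 1`
  have hfin : (criticalSet (𝓡∂ (n + 1)) f).Finite := IsMorse.finite_criticalSet_holds hf.1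
  have hle1 : ∀ z, IsMCriticalPt (𝓡∂ (n + 1)) f z → morseIndex (𝓡∂ (n + 1)) f z ≤ 1 := by
    intro z hz
    by_contra hlt
    have h2le : 2 ≤ morseIndex (𝓡∂ (n + 1)) f z := by omega
    have hmem : z ∈ criticalSetOfIndex (𝓡∂ (n + 1)) f (morseIndex (𝓡∂ (n + 1)) f z) := ⟨hz, rfl⟩
    have hfin' : (criticalSetOfIndex (𝓡∂ (n + 1)) f (morseIndex (𝓡∂ (n + 1)) f z)).Finite :=
      hfin.subset (criticalSetOfIndex_subset _ f _)
    rw [(Set.ncard_eq_zero hfin').1 (h2 _ h2le)] at hmem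
    exact hmem
  have hidx' : ∀ x : ↥(f ⁻¹' Iic a), (𝓡∂ (n + 1)).IsInteriorPoint x →
      IsMCriticalPt (𝓡∂ (n + 1)) (fun x : ↥(f ⁻¹' Iic a) => f x + (1 - a)) x →
      morseIndex (𝓡∂ (n + 1)) (fun x : ↥(f ⁻¹' Iic a) => f x + (1 - a)) x + 2 ≤ n + 1 := by
    intro x _ hx
    have hx' := (hcrit x).1 hx
    rw [hidx x hx']
    have := hle1 x.1 hx'
    omega
  obtain ⟨hpre, hne⟩ := hF.isPreconnected_boundary_and_nonempty hidx'
  -- the boundary of `{f ≤ a}` is the level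
  have hbd : ∀ x : ↥(f ⁻¹' Iic a), x ∈ (𝓡∂ (n + 1)).boundary ↥(f ⁻¹' Iic a) ↔ f x.1 = a := fun x =>
    isBoundaryPoint_sublevel_iff hf.1.1 a hint hreg' x
  have himg : Subtype.val '' ((𝓡∂ (n + 1)).boundary ↥(f ⁻¹' Iic a)) = f ⁻¹' {a} := by
    ext z
    constructor
    · rintro ⟨x, hx, rfl⟩; exact (hbd x).1 hx
    · intro hz
      exact ⟨⟨z, le_of_eq hz⟩, (hbd _).2 hz, rfl⟩
  rw [← himg]
  exact ⟨hne.image _, hpre.image _ continuous_subtype_val.continuousOn⟩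

end Literature.Topology.FourManifolds
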